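import Summits.BirchSwinnertonDyer.BirchSwinnertonDyer.Theorems.PrintCf2RamifiedOffTYZMoverSumBlocksSix
import Literature.NumberTheory.EllipticCurves.TianYuanZhang2017.CMPointFrobeniusValueDisplays
import Summits.BirchSwinnertonDyer.BirchSwinnertonDyer.Theorems.PrintCf2RamifiedOffTYZEvenOmegaIdentity
import HarnessLib

/-!
# Line `offtyz-v7`, crux stmt-BirchSwinnertonDyer-20509 — THE EVEN Ω-IDENTITY (★★)₆, TYPED (LEAD cruxlead-20509 g13, cycle 14) — PROVED 2026-08-30 (LEAD g14, p754196; see the last theorem)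

Crux WORKFILE (not a Theorems file): the research statement of record for the EVEN sector of C⁺ (item 23431) and for the `s = 1` even stratum of
item 23432, as a `Prop` definition `EvenOmegaMotion` plus its two consumer-shaped corollary statements.  Companion of the memo
`Lines/offtyz_v7_RegimeFreeLaw.md` §5b (numerical evidence: 10135/10135 square-free `n ≡ 6 (mod 8)`, `k ≤ 5`, `n ≤ 10⁵`, all `s ∈ {1,3,5}`, 0 exceptions;
instrument `instruments/even_identity_check.py` in the LEAD folder; block characters computed by the REGIME-FREE law p743258/p743484).
Its `x_2x_j`-row is g9's (★)₆ `adjugate_monskyMatrixEven_inl_inr_eq_sum_filter` read through `MoverAssembly.kummer_chi_eq_cramer_six_all` (PROVED,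
p743804 pending); the `x_ax_b`, `x_im x_j`, `x_im x_2` rows are OPEN (route: g6/g9 forest calculus `QFormEvenForest` / `QFormIdentitySix`).
BSD is not proved by any of this; nothing here is asserted or cited as a fact.

STATEMENT (informal).  `n = 2p₁⋯p_k ≡ 6 (mod 8)` square-free, `M = M_even(p)` (Monsky), `A_j = adj(M)_{(inl j)(inr j)}`, `A′_j = adj(M)_{(inr j)(inl j)}`,
`t_j = (−1/p_j)₊`, `G = Σ_i t_i A_i`; for every automorphism `g` of `ℍ′_n` with bits `x_im = [g(i) ≠ i]`, `x_2 = [g(i√−2) ≠ i√−2]`, `x_j = [g(i√−p_j) ≠ i√−p_j]`: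
  `[g·g moves P(n)] = x_im·Σ_j (A_j + A′_j + G) x_j + x_im x_2·Σ_j t_j (A_j + A′_j) + x_2·Σ_j A_j x_j + Σ_{a<b} (A_a + A_b) x_a x_b`.
Since `adj(M)` has rank `≤ 1` (`det M = 0`: `s(n)` is odd), this gives «some square moves `P(n)` ⟺ `s(n) = 1`» for every square-free `n ≡ 6 (mod 8)`.
-/

noncomputable section

open scoped Classical

open WeierstrassCurve WeierstrassCurve.Affine Finset Matrix Literature.NumberTheory.EllipticCurves
  Literature.NumberTheory.EllipticCurves.TianYuanZhang2017
  Literature.NumberTheory.EllipticCurves.TianYuanZhang2017.W2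
  Literature.NumberTheory.EllipticCurves.HeathBrown1994
  Literature.NumberTheory.EllipticCurves.HeathBrown1994.Families
  Summit.BirchSwinnertonDyer.Rank1Residual.P2.GenusPeriodTransferLayer
  Summit.BirchSwinnertonDyer.PrintCf2.MoverAssembly

set_option autoImplicit false

namespace Summit.BirchSwinnertonDyer.PrintCf2.EvenOmega

/-- The bit `[g x ≠ x] ∈ 𝔽₂` of an automorphism at an element. [folklore] -/
def bitAt {n : ℕ} (D : GenusPointData n) (g : D.H ≃ₐ[ℚ] D.H) (x : D.H) : ZMod 2 := if g x = x then 0 else 1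

/-- **The even Ω-form** `Q_p(g)`: the right side of (★★)₆ as a function of the adjugate of Monsky's even matrix and the bits of `g`
(`x_im`, `x_2`, `x_j`), with `t_j = (−1/p_j)₊`. [cite: HeathBrown1994SelmerCongruentII, Appendix (Monsky), typescript p. 41 L20–L36] -/
def evenOmegaForm {k n : ℕ} (p : Fin k → ℕ) (D : GenusPointData n) (g : D.H ≃ₐ[ℚ] D.H) : ZMod 2 :=
  let A : Fin k → ZMod 2 := fun j => (monskyMatrixEven p).adjugate (Sum.inl j) (Sum.inr j)
  let A' : Fin k → ZMod 2 := fun j => (monskyMatrixEven p).adjugate (Sum.inr j) (Sum.inl j)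
  let t : Fin k → ZMod 2 := fun j => addLegendreSym (-1) (p j)
  let G : ZMod 2 := ∑ i, t i * A i
  let xim : ZMod 2 := bitAt D g D.im
  let x2 : ZMod 2 := bitAt D g (D.im * D.sqrtNeg 2)
  let x : Fin k → ZMod 2 := fun j => bitAt D g (D.im * D.sqrtNeg (p j))
  xim * (∑ j, (A j + A' j + G) * x j) + xim * x2 * (∑ j, t j * (A j + A' j)) + x2 * (∑ j, A j * x j) +
    ∑ a, ∑ b, (if a < b then (A a + A b) * x a * x b else 0)

/-- **(★★)₆ THE EVEN Ω-IDENTITY — CONJECTURE (research statement, nothing asserted).**  For every tuple of distinct odd primes with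
`∏ pᵢ ≡ 3 (mod 4)`, `n = 2∏pᵢ`, every genus-point datum `D` carrying the printed displays (`Printed`, `CMPointRingClassFrobeniusValuePrinted`) and
TYZ Thm 1.1, and every automorphism `g` of `ℍ′_n`: `g·g` moves `P(n)` iff `evenOmegaForm p D g = 1`.
Evidence: LEAD g13 census 10135/10135 (`n ≤ 10⁵`, `k ≤ 5`), `Lines/offtyz_v7_RegimeFreeLaw.md` §5b; the `x_2x_j`-row is proved ((★)₆ + p743804).
[cite: TianYuanZhang2017, §3.1, Prop. 3.2 (2), Thm. 3.6 (2), proof of Lemma 3.21] [cite: HeathBrown1994SelmerCongruentII, Appendix (Monsky)] -/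
def EvenOmegaMotion : Prop :=
  ∀ (k : ℕ) (p : Fin k → ℕ), (∀ i, (p i).Prime) → (∀ i, Odd (p i)) → Function.Injective p → (∏ i, p i) % 4 = 3 →
    ∀ (n : ℕ), n = 2 * ∏ i, p i → ∀ (D : GenusPointData n), D.Printed → D.CMPointRingClassFrobeniusValuePrinted →
      thm11_parity_of_scriptL → ∀ g : D.H ≃ₐ[ℚ] D.H, D.galPt (g * g) (D.P n) ≠ D.P n ↔ evenOmegaForm p D g = 1

/-- **Consumer shape 1 (what C⁺'s even lower half needs): FULL LAYER-1 SILENCE at `s ≥ 3`** — under (★★)₆, for square-free `n ≡ 6 (mod 8)` with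
`#Sel₂(E_n) = 2^{2+s}`, `s ≥ 2` (then `adj M_even = 0`), every square of `Gal(ℍ′_n/ℚ)` fixes `P(n)`; with the even door p729925 and the even half-mover
p733231 this is the LOWER HALF `2 ∣ 𝓛(n)` on the whole even jump-one class `{x(R) ∉ ⟨−1, 2, n⟩ℚ²}`.  Stated as an implication to be proved from
`EvenOmegaMotion`; NOT proved here (needs `adj = 0` for corank `≥ 2`). -/
def EvenSilenceOfOmega : Prop :=
  EvenOmegaMotion → ∀ (k : ℕ) (p : Fin k → ℕ), (∀ i, (p i).Prime) → (∀ i, Odd (p i)) → Function.Injective p → (∏ i, p i) % 4 = 3 →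
    ∀ (n : ℕ), n = 2 * ∏ i, p i → ∀ (D : GenusPointData n), D.Printed → D.CMPointRingClassFrobeniusValuePrinted →
      thm11_parity_of_scriptL → ∀ s : ℕ, 2 ≤ s → Nat.card ((congruentNumberCurve n).selmerGroup 2) = 2 ^ (2 + s) →
        ∀ g : D.H ≃ₐ[ℚ] D.H, D.galPt (g * g) (D.P n) = D.P n

/-- **Consumer shape 2 (Smith's `S(6)` complete): `#Sel₂(E_n) = 8 ⟹` some square moves `P(n)`** for EVERY square-free `n ≡ 6 (mod 8)` (no `u¹ ≠ 0`
hypothesis: if `u¹ = 0` the element with bits `e_im + e_j`, `u²_j = 1`, moves), hence BSD(E_n, 2) through the even door p677864.  Stated as an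
implication from `EvenOmegaMotion`; NOT proved here. -/
def EvenMoverOfOmega : Prop :=
  EvenOmegaMotion → ∀ (k : ℕ) (p : Fin k → ℕ), (∀ i, (p i).Prime) → (∀ i, Odd (p i)) → Function.Injective p → (∏ i, p i) % 4 = 3 →
    ∀ (n : ℕ), n = 2 * ∏ i, p i → ∀ (D : GenusPointData n), D.Printed → D.CMPointRingClassFrobeniusValuePrinted →
      thm11_parity_of_scriptL → Nat.card ((congruentNumberCurve n).selmerGroup 2) = 8 →
        ∃ g : D.H ≃ₐ[ℚ] D.H, D.galPt (g * g) (D.P n) ≠ D.P n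

/-! ## STATUS (LEAD g13, 2026-08-30 00:2xZ): THE CLOSED-FORM REDUCTION IS WRITTEN AND LANDING
`Theorems/…EvenOmegaDefs` (p745090 ✓: the matrix-side definitions below, verbatim), `…EvenSquareFormBlocks` (p745864 ✓), `…EvenSquareFormLevelOne`
(p746499 ✓), `…LevelTwo` (p746648 ✓), `…LevelThree` (p746771: ★ `galPt_mul_self_P_eq_add_evenSquareForm`), `…EvenSquareFormMatrixBridge`
(★★ `galPt_mul_self_P_eq_add_evenSquareFormMatrix`: for EVERY g, `g·g·P(n) = P(n) + val(evenSquareFormMatrix p (bits g))·τ(1)`), and the two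
CONSUMERS `…EvenOmegaSilence` (★★★ `two_dvd_scriptL_even_of_evenOmega_of_facts`: identity-for-p ⟹ even lower half of C⁺, all k) and
`…EvenOmegaMover` (★★★ `selmerEight_six_bsdp_two_of_evenOmega_of_facts`: identity-for-p ⟹ `#Sel₂ = 8 ⟹ BSD₂` on all of S(6)).  So
`EvenOmegaMatrixIdentity` below is now EXACTLY the missing theorem; `EvenOmegaMotion` follows from it by the Bridge (up to the `bitAt` spelling). -/

/-! ## The same identity as a PURE 𝔽₂-MATRIX STATEMENT (Legendre symbols only) — what a g6-style forest proof would establish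

Reading g8's even square formula (`SquareSilenceEven.galPt_mul_self_P_eq_add_even`) through the block laws — even blocks: the REGIME-FREE law
(p743258/p743484), odd blocks `≡ 5`: g8's `MoverBlockForm.sqMotion_eq_kerSum_dotProduct_bits` (regime-free since g10) — and the cofactor parities
`|𝓛(x)| ≡ det M(x)` (`x ≡ 1, 2, 3 (mod 8)`: TYZ Thm 1.1 + Smith rows 1–3 + Monsky, tree lemmas `scriptL_parity_eq_coblockWeight_six/_odd` and the
row-two analogue), the square motion `[g·g moves P(n)]` is the value at the bits of `g` of the explicit form `evenSquareFormMatrix p` below; so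
`EvenOmegaMotion` is `EvenOmegaMatrixIdentity` + that closed-form reduction (the reduction is bookkeeping of the lineage's kind, `MoverSumBlocksSix*`,
not yet written for levels 2–3).  The chains: level 1 `n → 2d_S` (`d_{Sᶜ} ≡ 1 (8)`, CM block) and `n → d_W` (`d_W ≡ 7`, no CM term); level 2
`d_W → d_T` (`d_T ≡ 5`, `d_{W∖T} ≡ 3`); level 3 `2d_S → d_W → d_T` (`d_{S∖W} ≡ 1 (4)`); a block `≡ 5` never sits directly under an even block. -/

/-- The `(m+1) × (m+1)` matrix `N_S = [[A_S + D₋₂, z_S], [0, 0]]` of the even block `2d_S` (rows: Frobenius bit vectors and a zero row).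
[cite: HeathBrown1994SelmerCongruentII, Appendix (Monsky)] [cite: Stevenhagen1995RedeiMatrices, §2] -/
def blockSixMatrix {k : ℕ} (p : Fin k → ℕ) (S : Finset (Fin k)) :
    Matrix (Fin S.card ⊕ Unit) (Fin S.card ⊕ Unit) (ZMod 2) :=
  Matrix.fromBlocks (legendreMatrix (QForm.blockPrimes p S) + legendreDiagonal (QForm.blockPrimes p S) (-2))
    (Matrix.of fun j (_ : Unit) => addLegendreSym 2 (QForm.blockPrimes p S j))
    (0 : Matrix Unit (Fin S.card) (ZMod 2)) (0 : Matrix Unit Unit (ZMod 2))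

/-- `κ^S` read back on `Fin k` (zero outside `S`): the prime coordinates of the kernel sum of `N_S`. [folklore] -/
def blockKappaSix {k : ℕ} (p : Fin k → ℕ) (S : Finset (Fin k)) (i : Fin k) : ZMod 2 :=
  if h : i ∈ S then QForm.kerSum (blockSixMatrix p S) (Sum.inl ((S.orderIsoOfFin rfl).symm ⟨i, h⟩)) else 0

/-- `κ^S_∞`: the `√2`-coordinate of the kernel sum of `N_S`. [folklore] -/
def blockKappaSixInf {k : ℕ} (p : Fin k → ℕ) (S : Finset (Fin k)) : ZMod 2 :=
  QForm.kerSum (blockSixMatrix p S) (Sum.inr ())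

/-- `det M_even` of a sub-block (the parity of `|𝓛(2d_X)|` for `2d_X ≡ 2 (mod 8)`, Smith row 2; `1` on the empty block: `𝓛(2) = ±1`).
[cite: HeathBrown1994SelmerCongruentII, Appendix (Monsky)] [cite: Smith2016CongruentDensity, Thm. 2.2 row 2] -/
def blockWeightEven {k : ℕ} (p : Fin k → ℕ) (X : Finset (Fin k)) : ZMod 2 := (monskyMatrixEven (QForm.blockPrimes p X)).det

/-- `det M_odd` of a sub-block (the parity of `|𝓛(d_X)|` for `d_X ≡ 1, 3 (mod 8)`, Smith rows 1, 3).
[cite: HeathBrown1994SelmerCongruentII, Appendix (Monsky)] [cite: Smith2016CongruentDensity, Thm. 2.2 rows 1, 3] -/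
def blockWeightOdd {k : ℕ} (p : Fin k → ℕ) (X : Finset (Fin k)) : ZMod 2 := (monskyMatrixOdd (QForm.blockPrimes p X)).det

/-- **The chain coefficient `c_T`** of an odd block `d_T ≡ 5 (mod 8)`: sum over `T ⊊ W ⊆ S ⊆ univ` with `d_{Sᶜ} ≡ 1 (8)` (or `S = univ`), `d_W ≡ 7 (8)`,
`d_{S∖W} ≡ 1 (mod 4)`, `d_{W∖T} ≡ 3 (8)` of `det M_odd(Sᶜ)·det M_even(S∖W)·det M_odd(W∖T)`.  LEAD g13 law (verified 8525/8525):
`c_T = [s(n/d_T) = 1]·⟨z, u¹(n/d_T)⟩`. [cite: TianYuanZhang2017, Thm. 1.1, Thm. 3.6 (2), §3.4] -/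
def chainCoeff {k : ℕ} (p : Fin k → ℕ) (T : Finset (Fin k)) : ZMod 2 :=
  ∑ S : Finset (Fin k), ∑ W : Finset (Fin k),
    if T ⊆ W ∧ T ≠ W ∧ W ⊆ S ∧ (∏ i ∈ Sᶜ, p i) % 8 = 1 ∧ (∏ i ∈ W, p i) % 8 = 7 ∧ (∏ i ∈ S \ W, p i) % 4 = 1 ∧
        (∏ i ∈ W \ T, p i) % 8 = 3 then
      blockWeightOdd p Sᶜ * blockWeightEven p (S \ W) * blockWeightOdd p (W \ T) else 0

/-- **The even square form, matrix side**: `Ψ_n(x_im, x_2, x)` = Σ over even blocks `2d_S` (`d_{Sᶜ} ≡ 1 (8)`, incl. `S = univ`) of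
`det M_odd(Sᶜ)·[x_im + x_2 + Σ_S x_j = 0]·(Σ_{j∈S} κ^S_j x_j + κ^S_∞ x_2)` + Σ over odd blocks `d_T ≡ 5 (8)` of `c_T·[x_im + Σ_T x_j = 0]·(Σ_{j∈T} ρ^T_j x_j)`
(indicators written as `1 + linear form`, valid over `𝔽₂`). [cite: TianYuanZhang2017, §3.1, Thm. 3.6 (1)(2), proof of Lemma 3.21] -/
def evenSquareFormMatrix {k : ℕ} (p : Fin k → ℕ) (xim x2 : ZMod 2) (x : Fin k → ZMod 2) : ZMod 2 :=
  (∑ S : Finset (Fin k), if (∏ i ∈ Sᶜ, p i) % 8 = 1 then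
      blockWeightOdd p Sᶜ * (1 + xim + x2 + ∑ j ∈ S, x j) * (∑ j ∈ S, blockKappaSix p S j * x j + blockKappaSixInf p S * x2) else 0) +
  ∑ T : Finset (Fin k), if (∏ i ∈ T, p i) % 8 = 5 then
      chainCoeff p T * (1 + xim + ∑ j ∈ T, x j) * (∑ j ∈ T, QForm.blockRho p T j * x j) else 0

/-- **The even Ω-form, matrix side** (right side of (★★)₆ on abstract bits). [cite: HeathBrown1994SelmerCongruentII, Appendix (Monsky)] -/
def evenOmegaFormMatrix {k : ℕ} (p : Fin k → ℕ) (xim x2 : ZMod 2) (x : Fin k → ZMod 2) : ZMod 2 :=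
  let A : Fin k → ZMod 2 := fun j => (monskyMatrixEven p).adjugate (Sum.inl j) (Sum.inr j)
  let A' : Fin k → ZMod 2 := fun j => (monskyMatrixEven p).adjugate (Sum.inr j) (Sum.inl j)
  let t : Fin k → ZMod 2 := fun j => addLegendreSym (-1) (p j)
  let G : ZMod 2 := ∑ i, t i * A i
  xim * (∑ j, (A j + A' j + G) * x j) + xim * x2 * (∑ j, t j * (A j + A' j)) + x2 * (∑ j, A j * x j) +
    ∑ a, ∑ b, (if a < b then (A a + A b) * x a * x b else 0)

/-- **(★★)₆-M THE EVEN Ω-IDENTITY AS A LEGENDRE-SYMBOL IDENTITY — CONJECTURE (research statement; decidable for each tuple).**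
For distinct odd primes with `∏ pᵢ ≡ 3 (mod 4)` and all `(x_im, x_2, x) ∈ 𝔽₂^{k+2}`: `evenSquareFormMatrix p = evenOmegaFormMatrix p` pointwise.
Verified (LEAD g13, instruments/even_identity_check.py) for every square-free `n = 2∏pᵢ ≤ 10⁵` with `k ≤ 5` (10135 tuples, all bit vectors), and
IN LEAN by `native_decide` on THESE definitions for `p = (3,5), (5,7), (3,37), (3,73), (17,19), (3,5,13), (3,11,19)` (scratch; the tuples with
`s = 3` — `(3,73)`, `(17,19)`, `(3,11,19)` — have `evenOmegaFormMatrix = 0`; the non-member `(3,5,7)`, `n ≡ 2 (8)`, fails as it should).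
Its `x_2x_j`-coefficient is g9's (★)₆ (PROVED, `QFormIdentitySix.adjugate_monskyMatrixEven_inl_inr_eq_sum_filter`). -/
def EvenOmegaMatrixIdentity : Prop :=
  ∀ (k : ℕ) (p : Fin k → ℕ), (∀ i, (p i).Prime) → (∀ i, Odd (p i)) → Function.Injective p → (∏ i, p i) % 4 = 3 →
    ∀ (xim x2 : ZMod 2) (x : Fin k → ZMod 2), evenSquareFormMatrix p xim x2 x = evenOmegaFormMatrix p xim x2 x

/-- **STATUS (LEAD cruxlead-20509 g14, 2026-08-30): PROVED — no longer a conjecture.**  The research statement above is the tree theorem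
`QFormForest.evenOmegaMatrixIdentity_holds` (`Theorems/PrintCf2RamifiedOffTYZEvenOmegaIdentity.lean`, p754196; proof = `Lines/offtyz_v7_EvenOmegaProof.md`,
helper chain p749706 → p754196), stated there for the landed copies `EvenOmegaDefs.*` of the definitions of this file (byte-identical bodies, so the
transport is `rfl`).  Its consumers with `hΩ` discharged: `MoverAssembly.two_dvd_scriptL_even_allk_of_facts` (even-sector LOWER HALF of C⁺, all `k`)
and `MoverAssembly.selmerEight_six_bsdp_two_allk_of_facts` (`#Sel₂ = 8 ⟹ BSD₂` on all of S(6)), both modulo the printed facts.  BSD is not proved by this. -/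
theorem evenOmegaMatrixIdentity_proved : EvenOmegaMatrixIdentity := fun k p hp hodd hinj h3 xim x2 x =>
  Summit.BirchSwinnertonDyer.PrintCf2.QFormForest.evenOmegaMatrixIdentity_holds k p hp hodd hinj h3 xim x2 x

end Summit.BirchSwinnertonDyer.PrintCf2.EvenOmega

end
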